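import Literature.AlgebraicGeometry.ShimuraVarieties.UnitaryAuxiliaryHeckeQuotientDescent
import Literature.AlgebraicGeometry.ShimuraVarieties.UnitaryAuxiliaryTorusClassNumberProofs
import Literature.AlgebraicGeometry.ShimuraVarieties.UnitaryAuxiliaryTorusUnitLevel
import Literature.AlgebraicGeometry.ShimuraVarieties.UnitaryAuxiliaryReflexBookkeeping
import Literature.AlgebraicGeometry.ShimuraVarieties.UnitaryShimuraCanonicalModelTowerReflex
import HarnessLib

/-!
# `hDel♭` from F1 alone: the Galois case of line `a1-reflex-compositum` (binder `hDel` → `HypDel`), BY NAME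
# (cell `hodgecm-mathlib`, fan A, rung A-I; KEY `a1-tower-and-junction`, part (ii) in the by-name currency of
# ruling D-JUNCTION)

Summits side, binder subdirectory `CorCM/HypDel/`.  The crux workfile `A-plan/lines/a1-reflex-compositum.lean`
(sha16 785cc48e2d31c68c, REF1 PASS 2026-08-28T00:42:28Z, namespace `Summit.HodgeConjecture.CorCM.Cruxes.HypDel.ReflexCompositum`)
isolates the GALOIS CASE of Deligne's canonical-model theorem for the compact unitary datum as the node
`stub_galoisCase` (ruling D-I2, the Galois edition `hDel♭` — the only case the HC_CM headline consumes: `F` Galois CM,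
`6 ≤ [F:ℚ]`): for `L/ℚ` Galois, every complex record system `Sc` of `Sh(U(H), 𝔹²)` below a neat level `K₀` has an
`L`-form along `τ` with Shimura reciprocity (62) (`IsCanonicalDescentAt`).  This file PROVES that node from the ONE
printed citation F1 = `Aux.canonicalModel_exists_printed` ([Deligne1979ShimuraVarieties] 2.3.1 for the auxiliary Hodge-type
datum `(G × T₀, h_U × h_Φ)`, typed by B-typ03, p591128) and tree theorems only:

* CHAIN B of the B-side (B-plan2 / B-p07, `HeckeQuotient.galoisLegDescentOver_of_F1`, p594805: F1 ⟹ an `E♯`-form of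
  `Sc.Mc` with `IsCanonicalDescentOver Sc (algebraMap ↥E♯ ℂ)`, for adapted `Φ` with small reflex field and a level `L₀`
  of finite class number), fed with `Aux.exists_isAdapted`, `Aux.hasSmallReflex_of_isGalois` ([Shimura1998] §8.3
  Prop. 28), the unit level `Aux.unitLevel` (B-p15, p595606) and the class-number fact `Aux.finite_classGroup_printed_holds`
  (g5, B-p01, p596070, PROVED);
* the tower lemma in consumer shape `UnitaryCanonicalModel.forall_exists_form_of_reflexField` (A-p06, p596153:
  one `E♯`-form ⟹ the `∀ E ⊇ τ(L)·E*(Φ)` clause of stub (A));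
* `reflexDescent_of_isGalois` (the residual stub (B) is EMPTY for Galois `L`: `E := L`, `ιE := τ`), statement and
  proof verbatim from the skeleton.

`galoisCase_of_F1 : Aux.canonicalModel_exists_printed → <stub_galoisCase, verbatim>` — CONDITIONAL on the named fact F1
only (D-0014; no pack decl, no stub block as hypothesis).  HC_CM is proved only modulo the 7 printed citations until
rung 0 closes; this file discharges no binder: `HypDel` itself still needs the non-Galois residual (TIER G).

## References
* [Deligne1979ShimuraVarieties] 2.2.5, 2.3.1, Cor. 2.7.21; [Deligne1971TravauxShimura] Prop. 5.11, Cor. 5.7, Déf. 3.13;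
  [Shimura1998] §8.3 Prop. 28; [Liu2021] App. C Lem. C.14, Rem. C.15; [Milne2005ShimuraVarieties] Def. 12.8 (62).
-/

set_option autoImplicit false

noncomputable section

open Function MulAction NumberField IsDedekindDomain CategoryTheory CategoryTheory.Limits Matrix
  AlgebraicGeometry
open scoped Matrix ComplexOrder
open Literature.AlgebraicGeometry.Motives
open Literature.NumberTheory.Automorphic Literature.NumberTheory.Automorphic.UnitaryGroup
open Literature.NumberTheory.Automorphic.Liu2021.AppendixC (C5.OpenCompactSubgroup C5.SmallLevel)
open Literature.Geometry.ComplexHyperbolic Literature.Geometry.ComplexHyperbolic.BallModel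
open Literature.NumberTheory.Automorphic.ShimuraDissection
open Literature.AlgebraicGeometry.ShimuraVarieties
open Literature.AlgebraicGeometry.ShimuraVarieties.UnitaryCanonicalModel
open Literature.NumberTheory.ComplexMultiplication (traceField traceField_le_fieldRange)

namespace Summit.HodgeConjecture.CorCM.HypDel

/-- **The residual stub (B) of line a1 is EMPTY for Galois `L`** ([Shimura1998] §8.3 Prop. 28: for `L/ℚ` Galois the
reflex-trace field `E*(Φ) = traceField Φ` lies in `τ(L)`, tree theorem `traceField_le_fieldRange`): if, for some CM type
`Φ`, the complex tower `Sc.Mc` has `E`-forms with Shimura reciprocity (62) for `Aut(ℂ/E)` over every number field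
`E ⊇ τ(L)·E*(Φ)` inside `ℂ`, then it has an `L`-form along `τ` with reciprocity (`IsCanonicalDescentAt`) — take `E := L`,
`ιE := τ`; the `E`-formula at `(L, τ)` IS `IsCanonicalDescentAt`, definitionally.  Statement and proof = the skeleton's
`reflexDescent_of_isGalois` (a1-reflex-compositum.lean, sha16 785cc48e2d31c68c), verbatim.
[cite: Shimura1998, §8.3 Prop. 28] [cite: Deligne1979ShimuraVarieties, 2.2.5] -/
theorem reflexDescent_of_isGalois :
    ∀ (L : Type) [Field L] [NumberField L] [IsCMField L] [IsGalois ℚ L] (H : Matrix (Fin 3) (Fin 3) L) (τ : L →+* ℂ)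
      (T : GL (Fin 3) ℂ) (hT : formCongr (starRingEnd ℂ) T (H.map τ) = BallModel.J),
      (∀ τ' : L →+* ℂ, InfinitePlace.mk τ' ≠ InfinitePlace.mk τ → (H.map τ').PosDef) →
      (∀ v : Fin 3 → L, hermForm (cmConjRingHom L) H v v = 0 → v = 0) →
      ∀ K₀ : C5.OpenCompactSubgroup ↥(finAdelic (↥(maximalRealSubfield L)) L (IsCMField.complexConj L) 3 H),
        (∀ g : finAdelic (↥(maximalRealSubfield L)) L (IsCMField.complexConj L) 3 H,
          ∀ γ ∈ arithmeticLevel (↥(maximalRealSubfield L)) L (IsCMField.complexConj L) 3 H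
            (K₀.1.map (MulAut.conj g).toMonoidHom), IsOfFinOrder γ → γ = 1) →
          ∀ Sc : ComplexRecordSystem L H τ T hT K₀,
            (∃ Φ : CMType L, ∀ (E : Type) [Field E] [NumberField E] (ιE : E →+* ℂ),
              Set.range τ ⊆ Set.range ιE → (traceField Φ : Set ℂ) ⊆ Set.range ιE →
              ∃ (M : C5.SmallLevel K₀ ⥤ SchemeOver E) (e : (M ⋙ baseChangeHom ιE) ≅ Sc.Mc),
              letI : Algebra E ℂ := ιE.toAlgebra
              ∀ (K : C5.SmallLevel K₀) (σ : ℂ ≃ₐ[E] ℂ) (s : (FiniteAdeleRing (𝓞 L) L)ˣ),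
                IsArtinCorrespondent L τ s σ.toRingEquiv →
                ∀ (v₃ : Fin 3 → L) (x : Ball), IsLinePoint L τ T v₃ x →
                  ∀ d : finAdelic (↥(maximalRealSubfield L)) L (IsCMField.complexConj L) 3 H,
                    IsDiagTwist L H v₃ (recipFactor L s) d →
                    ∀ a : finAdelic (↥(maximalRealSubfield L)) L (IsCMField.complexConj L) 3 H,
                      σ • (AlgPoints.baseChangeEquiv ιE (M.obj K)).symm
                          (AlgPoints.map (e.inv.app K) ((Sc.pts K).symm (ShimuraSet.mk L H τ T hT K.1.1 x a))) =
                        (AlgPoints.baseChangeEquiv ιE (M.obj K)).symm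
                          (AlgPoints.map (e.inv.app K)
                            ((Sc.pts K).symm (ShimuraSet.mk L H τ T hT K.1.1 x (d * a))))) →
            ∃ (M : C5.SmallLevel K₀ ⥤ SchemeOver L) (e : (M ⋙ baseChangeHom τ) ≅ Sc.Mc),
              IsCanonicalDescentAt Sc M e := by
  intro L _ _ _ _ H τ T hT hpos hanis K₀ htf Sc hA
  obtain ⟨Φ, hΦ⟩ := hA
  have hE : (traceField Φ : Set ℂ) ⊆ Set.range τ := by
    intro x hx
    obtain ⟨y, hy⟩ := AlgHom.mem_fieldRange.1 (traceField_le_fieldRange (AlgHom.id ℚ L) τ Φ hx)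
    exact ⟨y, by simpa using hy⟩
  obtain ⟨M, e, hrec⟩ := hΦ L τ subset_rfl hE
  exact ⟨M, e, hrec⟩

/-- **`hDel♭` from F1 alone — the Galois case of Deligne's canonical model for the compact unitary datum, conditional
only on the printed citation F1** (`Aux.canonicalModel_exists_printed`, [Deligne1979ShimuraVarieties] 2.3.1 on the auxiliary
Hodge-type datum).  Conclusion = the registered node `stub_galoisCase` of line a1 VERBATIM: for every Galois CM field
`L`, Hermitian `H` of signature `(2,1)` at `τ` and definite elsewhere, anisotropic, every neat level `K₀` and every
complex record system `Sc`, an `L`-form `(M, e : M ⊗_{L,τ} ℂ ≅ Sc.Mc)` with Shimura reciprocity (62) at the diagonal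
special pairs (`IsCanonicalDescentAt Sc M e`).  Proof (CHAIN B, [Deligne1971TravauxShimura] Prop. 5.11 + Cor. 5.7 as
assembled by the B-side): pick an adapted CM type `Φ` (`Aux.exists_isAdapted`); `L/ℚ` Galois ⟹ `E*(Φ) ⊆ τ(L)`
(`Aux.hasSmallReflex_of_isGalois`, [Shimura1998] §8.3 Prop. 28); the unit level `Aux.unitLevel L` of the auxiliary
torus has finite class group (`Aux.finite_classGroup_printed_holds`); `HeckeQuotient.galoisLegDescentOver_of_F1 hF1`
yields an `E♯`-form with `IsCanonicalDescentOver`; the tower lemma (`forall_exists_form_of_reflexField`) spreads it to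
every `E ⊇ τ(L)·E*(Φ)`; `reflexDescent_of_isGalois` specialises to `E := L`.
[cite: Deligne1979ShimuraVarieties, 2.2.5 and 2.3.1] [cite: Deligne1971TravauxShimura, Prop. 5.11, Cor. 5.7]
[cite: Shimura1998, §8.3 Prop. 28] [cite: Liu2021, App. C Lem. C.14] -/
theorem galoisCase_of_F1 (hF1 : Aux.canonicalModel_exists_printed) :
    ∀ (L : Type) [Field L] [NumberField L] [IsCMField L] [IsGalois ℚ L] (H : Matrix (Fin 3) (Fin 3) L) (τ : L →+* ℂ)
      (T : GL (Fin 3) ℂ) (hT : formCongr (starRingEnd ℂ) T (H.map τ) = BallModel.J),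
      (∀ τ' : L →+* ℂ, InfinitePlace.mk τ' ≠ InfinitePlace.mk τ → (H.map τ').PosDef) →
      (∀ v : Fin 3 → L, hermForm (cmConjRingHom L) H v v = 0 → v = 0) →
      ∀ K₀ : C5.OpenCompactSubgroup ↥(finAdelic (↥(maximalRealSubfield L)) L (IsCMField.complexConj L) 3 H),
        (∀ g : finAdelic (↥(maximalRealSubfield L)) L (IsCMField.complexConj L) 3 H,
          ∀ γ ∈ arithmeticLevel (↥(maximalRealSubfield L)) L (IsCMField.complexConj L) 3 H
            (K₀.1.map (MulAut.conj g).toMonoidHom), IsOfFinOrder γ → γ = 1) →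
          ∀ Sc : ComplexRecordSystem L H τ T hT K₀,
            ∃ (M : C5.SmallLevel K₀ ⥤ SchemeOver L) (e : (M ⋙ baseChangeHom τ) ≅ Sc.Mc),
              IsCanonicalDescentAt Sc M e := by
  intro L _ _ _ _ H τ T hT hpos hanis K₀ htf Sc
  obtain ⟨Φ, hΦ⟩ := Aux.exists_isAdapted (L := L) τ
  haveI : Finite (Aux.classGroup L (Aux.unitLevel L)) := Aux.finite_classGroup_printed_holds L (Aux.unitLevel L)
  obtain ⟨M₁, e₁, h₁⟩ := HeckeQuotient.galoisLegDescentOver_of_F1 hF1 L H τ T hT hpos hanis K₀ htf Sc Φ hΦ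
    (Aux.hasSmallReflex_of_isGalois L Φ τ) (Aux.unitLevel L)
  exact reflexDescent_of_isGalois L H τ T hT hpos hanis K₀ htf Sc ⟨Φ, forall_exists_form_of_reflexField Φ Sc M₁ e₁ h₁⟩

end Summit.HodgeConjecture.CorCM.HypDel

end
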